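import Mathlib.LinearAlgebra.Dimension.FreeAndStrongRankCondition
import Mathlib.LinearAlgebra.Basis.VectorSpace
import Mathlib.RingTheory.SimpleModule.Basic
import Mathlib.Algebra.DirectSum.Module
import Mathlib.Algebra.MonoidAlgebra.Basic
import Mathlib.Data.Complex.Basic
import HarnessLib

/-!
# Liu 2021, Prop. 4.13 (proof, multiplicity one) ⇒ the `μ`-block of `H¹_{B,τ'}(A_∞, ℂ)` is the
# image of the CM pull-back map of Thm. 4.18 — Step 1 of the «combined reading», in the kernel

Yifeng Liu, *Fourier–Jacobi cycles and arithmetic relative trace formula*, Cambridge J. Math. **9**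
(2021), no. 1, 1–147 = arXiv:2102.11518 [Liu2021]; TeX source `FJcycle.tex` of the arXiv e-print
(md5 `6db49a74122d2cb0f224fa1b39488a0c`), line numbers `l. NNNN` below.

## Why this file (the gap it closes)

The Hodge-CM programme consumes [Liu2021] §4.2 through ONE hypothesis which is not a printed
sentence but a CONSEQUENCE of several (the «combined reading», citation manifest row CF07,
conjunct (5) `Thm418C` / `Thm418Combined` of the stage-1 package file
`HodgeCM/Literature/AlbaneseUnitaryShimuraModules.lean`; on the single-block junction lineage it is
the ONLY [Liu2021] input of the theta binder).  In the package, for a weight-one character `μ` the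
`μ`-BLOCK of the `ℂ[G]`-module `H = H¹_{B,τ'}(A_∞, ℂ)` (`G = U(𝕍)(𝔸_F^∞)`) is defined INTRINSICALLY,
`block μ := ⨆_{(ε,χ)} ⨆_{ψ : ω(μ,ε,χ) →ₗ[ℂ[G]] H} range ψ` — the sum of the images of ALL equivariant
maps out of the oscillator modules `ω(μ,ε,χ)` — because the carrier `Ω(μ) ⊗_{M_μ} ℂ` of Liu's
pull-back map is not a package type.  The consumed sentence says: every `K`-fixed vector of
`block μ` restricts, on the identity component, into the span of the CM pull-back classes.  Its
derivation from print (the literature seats' «R8 §E», Steps 1–5; CF07 cell (iii)) begins with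

  STEP 1. The image of the pull-back map (4.2) `Ω(μ) ⊗_{M_μ} ℂ → H¹_{B,τ'}(A_∞, ℂ)` (proof of
  Thm. 4.18, ll. 2247–2270: injective, inducing `Ω(μ) ⊗_{M_μ} ℂ ≃ ⊕_{ε,χ} ω(μ,ε,χ)`) CONTAINS — in
  fact equals — the intrinsic `block μ`.

The prose derivations of record obtain Step 1 from Prop. 4.13 + «multiplicity one» + the pairwise
non-isomorphy of the summands (Thm. 4.18 (2) and App. D Lem. D.1 (3), the latter displayed by the
package as the model hypothesis `MuSeparated`).  THIS FILE PROVES STEP 1 IN THE KERNEL, generically,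
and shows that it needs ONLY the multiplicity-one sentence of the proof of Prop. 4.13 —

  [Liu2021, proof of Prop. 4.13, last sentence, l. 2145], AS PRINTED: "Thus, we may apply the above
  discussions to the representation `π` to conclude that the dimension of
  `H¹_{B,τ'}(A_∞,ℂ)[ω(μ,ε,χ)]` is `1`. The proposition follows."  (Used by Liu in exactly this form
  at ll. 2163–2166: "`Hom_{ℚ_ℓ^ac[G(𝔸_F^∞)]}(ι_ℓ ∘ ω(μ,ε,χ), H¹_ét(A_∞ ⊗_{E,τ'} ℂ, ℚ_ℓ^ac))` is a
  representation of `Gal(ℂ/τ'(E))` over `ℚ_ℓ^ac`. By Proposition 4.13, such representation is an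
  `ℓ`-adic character", i.e. the multiplicity space `Hom_G(ω(μ,ε,χ), H)` is one-dimensional.)

TYPING of l. 2145: `Module.rank ℂ (ω(t) →ₗ[ℂ[G]] H) ≤ 1` (we assume `≤ 1`, which the printed `= 1`
implies).  With it: any non-zero equivariant `j : ω(t) → H` spans `Hom_{ℂ[G]}(ω(t), H)`, so EVERY
equivariant `ψ : ω(t) → H` is a scalar multiple of `j` and `range ψ ≤ range j`
(`range_le_range_of_rank_hom_le_one`); for the pull-back map `j : ⊕_a ω(μ,a) → H` (injective, each
`ω(μ,a) ≠ 0` — Def. 4.11 "irreducible"), the components `j ∘ lof a` are non-zero, hence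
`block μ = range j` (`iSup_iSup_range_eq_range_of_rank_hom_le_one`).  No direct-sum decomposition of
`H` (Prop. 4.13's display), no Thm. 4.18 (2), no `MuSeparated`, no Schur lemma is used: the printed
rank bound already encodes separation (two isomorphic summands `ω(t) ≅ ω(t')` inside `H` would give
rank ≥ 2).

For comparison the file ALSO proves Step 1 along the route of the prose derivations of record
(section `Decomposition`): from a decomposition `e : H ≃ ⊕_t Ω' t` into simple, pairwise
non-isomorphic summands (the package's records `Prop413`, `Irreducible`, `Thm418_2 ∧ MuSeparated`)
and an injective equivariant `j` on a sub-family of summands, again `block = range j`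
(`iSup_iSup_range_eq_range_of_decomposition`; Schur's lemma twice, no rank hypothesis) — so on the
five-sentence binder, conjunct (5) is implied by conjuncts (1)–(4) plus the map reading below.

The file then records the GLUE from Step 1 to the consumed shape (`combinedReading_of_block_le_range`,
`combinedReading_of_rank_hom_le_one`, `combinedReading_of_decomposition`): if the `K`-fixed vectors
in the image of `j` restrict into the span of the CM classes below some level (this is Steps 2–5
of the reading: Thm. 4.18 (1) `Ω(μ)^K ≃ Hom_E(A_K, A_μ)_ℚ`, Rem. 4.17, Lem. 2.4 (1), functoriality
— NOT formalised here, it stays a hypothesis `hmap` about `j` over abstract geometric carriers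
`W K`, `res K`, `cmCl K`), then so do the `K`-fixed vectors of `block μ`.  The final statements are
literally the package's `Thm418Combined res cmCl` with `block`, `oscImage`, `Ωt` unfolded
(instantiate `k := ℂ`, `R := MonoidAlgebra ℂ G`, `Ω := D.Ω`, `Fix K := fixedBy (Kof K) D.H`;
checked against a byte-for-byte mirror of the package structure: `exact` closes it).

## What is NOT here

Nothing of Liu's proofs (theta lifting, Arthur's multiplicity formula, Faltings, Thm. 4.15) is
formalised or asserted; no carrier of the programme's package is mentioned; no statement about
abelian varieties.  Everything is generic module algebra over a field `k` and a `k`-algebra `R`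
(at the model: `k = ℂ`, `R = ℂ[G]`), plus the `ℂ[G]` specialisation for legibility.  This file
introduces NO named fact (`def … : Prop`): all declarations are theorems.

## References

* [Liu2021] Prop. 4.13 with its proof l. 2145 (multiplicity one) and ll. 2163–2166; Def. 4.11
  (l. 2092–2096: `ω(μ,ε,χ)` irreducible); Thm. 4.18 with its proof map (4.2), ll. 2232–2270.
* Hodge-CM citation manifest, row CF07 (conjunct (5) `Thm418C`), `run/shared/lean/pub/hodge-director/
  CITATION-FIT.md`; R8 print word §E (pub-hodgecm2 lit-liu-2); package record
  `HodgeCM.Literature.Theta.LiuAlbaneseModuleDatum.Thm418Combined`.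
-/

namespace Literature.RepresentationTheory.Liu2021

open DirectSum

/-! ### Step 1 for ONE oscillator module: rank `≤ 1` of the multiplicity space -/

section RankOne

variable {k : Type*} [Field k] {R : Type*} [Ring R] [Algebra k R]
  {H : Type*} [AddCommGroup H] [Module R H] [Module k H] [IsScalarTower k R H]
  {Ω : Type*} [AddCommGroup Ω] [Module R Ω]

/-- **Multiplicity one ⇒ every equivariant map is a multiple of a given non-zero one.**  If the
multiplicity space `Hom_R(Ω, H)` has `k`-rank `≤ 1` ([Liu2021], proof of Prop. 4.13, l. 2145:
"the dimension of `H¹_{B,τ'}(A_∞,ℂ)[ω(μ,ε,χ)]` is `1`", typed as a rank bound) and `j : Ω → H` is a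
non-zero `R`-linear map, then every `R`-linear `ψ : Ω → H` is `c • j` for some scalar `c : k`.
[cite: Liu2021, Prop. 4.13, proof l. 2145 (multiplicity one); ll. 2163–2166] -/
theorem exists_eq_smul_of_rank_hom_le_one (hrank : Module.rank k (Ω →ₗ[R] H) ≤ 1)
    {j : Ω →ₗ[R] H} (hj : j ≠ 0) (ψ : Ω →ₗ[R] H) : ∃ c : k, ψ = c • j := by
  obtain ⟨v₀, hv₀⟩ := rank_le_one_iff.mp hrank
  obtain ⟨r, hr⟩ := hv₀ j
  obtain ⟨s, hs⟩ := hv₀ ψ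
  have hr0 : r ≠ 0 := by
    rintro rfl
    exact hj (by rw [← hr, zero_smul])
  refine ⟨s * r⁻¹, ?_⟩
  rw [← hs, ← hr, smul_smul, mul_assoc, inv_mul_cancel₀ hr0, mul_one]

/-- **Step 1, one summand.**  Under multiplicity one (rank of `Hom_R(Ω, H)` at most `1`,
[Liu2021] l. 2145), the range of ANY equivariant `ψ : Ω → H` lies in the range of a fixed non-zero
equivariant `j : Ω → H` (at the model: `j` = the pull-back map (4.2) of the proof of Thm. 4.18
restricted to the summand `ω(μ,ε,χ)`).
[cite: Liu2021, Prop. 4.13, proof l. 2145; Thm. 4.18, proof ll. 2247–2270, eq. (4.2)] -/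
theorem range_le_range_of_rank_hom_le_one (hrank : Module.rank k (Ω →ₗ[R] H) ≤ 1)
    {j : Ω →ₗ[R] H} (hj : j ≠ 0) (ψ : Ω →ₗ[R] H) :
    LinearMap.range ψ ≤ LinearMap.range j := by
  obtain ⟨c, rfl⟩ := exists_eq_smul_of_rank_hom_le_one hrank hj ψ
  rintro x ⟨y, rfl⟩
  rw [LinearMap.smul_apply]
  exact Submodule.smul_of_tower_mem _ c (LinearMap.mem_range_self j y)

/-- **Step 1, one summand, `iSup` form**: the sum of the ranges of all equivariant `ψ : Ω → H`
(the package's `oscImage`, as a `k`-subspace) EQUALS the range of any fixed non-zero equivariant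
`j : Ω → H`, under multiplicity one ([Liu2021] l. 2145).
[cite: Liu2021, Prop. 4.13, proof l. 2145; Thm. 4.18, proof ll. 2247–2270, eq. (4.2)] -/
theorem iSup_range_eq_range_of_rank_hom_le_one (hrank : Module.rank k (Ω →ₗ[R] H) ≤ 1)
    {j : Ω →ₗ[R] H} (hj : j ≠ 0) :
    (⨆ ψ : Ω →ₗ[R] H, (LinearMap.range ψ).restrictScalars k) =
      (LinearMap.range j).restrictScalars k :=
  le_antisymm
    (iSup_le fun ψ _ hx => range_le_range_of_rank_hom_le_one hrank hj ψ hx)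
    (le_iSup (fun ψ : Ω →ₗ[R] H => (LinearMap.range ψ).restrictScalars k) j)

end RankOne

/-! ### Step 1 for the whole `μ`-block: the family of summands `ω(μ, a)`, `a = (ε, χ)` -/

section Family

variable {k : Type*} [Field k] {R : Type*} [Ring R] [Algebra k R]
  {H : Type*} [AddCommGroup H] [Module R H] [Module k H] [IsScalarTower k R H]
  {A : Type*} [DecidableEq A] (Ω : A → Type*) [∀ a, AddCommGroup (Ω a)] [∀ a, Module R (Ω a)]

/-- The range of a linear map out of a direct sum is the sum of the ranges of its components.
[folklore] -/
private theorem range_eq_iSup_range_comp_lof (j : (⨁ a, Ω a) →ₗ[R] H) :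
    LinearMap.range j = ⨆ a, LinearMap.range (j ∘ₗ lof R A Ω a) := by
  apply le_antisymm
  · rintro _ ⟨x, rfl⟩
    induction x using DirectSum.induction_on with
    | zero => rw [map_zero]; exact zero_mem _
    | of a b =>
      exact Submodule.mem_iSup_of_mem a ⟨b, rfl⟩
    | add x y hx hy => rw [map_add]; exact add_mem hx hy
  · exact iSup_le fun a => LinearMap.range_comp_le_range _ _

/-- An injective linear map out of a direct sum of non-zero modules has non-zero components
(at the model: the pull-back map (4.2) is injective — proof of Thm. 4.18 — and each `ω(μ,ε,χ)`
is irreducible, in particular non-zero — Def. 4.11). [folklore] -/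
private theorem comp_lof_ne_zero [∀ a, Nontrivial (Ω a)] (j : (⨁ a, Ω a) →ₗ[R] H)
    (hj : Function.Injective j) (a : A) : j ∘ₗ lof R A Ω a ≠ 0 := by
  obtain ⟨x, hx⟩ := exists_ne (0 : Ω a)
  intro h
  have h1 : j (lof R A Ω a x) = j 0 := by
    rw [map_zero]
    exact LinearMap.congr_fun h x
  have h2 : lof R A Ω a x = lof R A Ω a 0 := by rw [map_zero]; exact hj h1
  exact hx (DirectSum.of_injective (β := Ω) a h2)

/-- **STEP 1 OF THE COMBINED READING, IN THE KERNEL.**  Let `j : ⊕_a Ω a → H` be an injective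
`R`-linear map out of a direct sum of non-zero `R`-modules (at the model: the pull-back map (4.2)
of the proof of [Liu2021] Thm. 4.18, precomposed with the isomorphism
`⊕_{ε,χ} ω(μ,ε,χ) ≃ Ω(μ) ⊗_{M_μ} ℂ` of its statement; injective by that proof; `ω(μ,ε,χ) ≠ 0` by
Def. 4.11), and suppose MULTIPLICITY ONE: `Hom_R(Ω a, H)` has `k`-rank `≤ 1` for every `a`
([Liu2021] proof of Prop. 4.13, l. 2145).  Then the INTRINSIC block
`⨆_a ⨆_{ψ : Ω a →ₗ[R] H} range ψ` — the package's `block μ` — EQUALS the range of `j`.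
Neither a decomposition of `H` (Prop. 4.13's display) nor the pairwise non-isomorphy of the
summands (Thm. 4.18 (2), Lem. D.1 (3) / `MuSeparated`) is used.
[cite: Liu2021, Prop. 4.13, proof l. 2145 (multiplicity one); Thm. 4.18 with proof ll. 2247–2270, eq. (4.2); Def. 4.11] -/
theorem iSup_iSup_range_eq_range_of_rank_hom_le_one [∀ a, Nontrivial (Ω a)]
    (hrank : ∀ a, Module.rank k (Ω a →ₗ[R] H) ≤ 1)
    (j : (⨁ a, Ω a) →ₗ[R] H) (hj : Function.Injective j) :
    (⨆ a, ⨆ ψ : Ω a →ₗ[R] H, (LinearMap.range ψ).restrictScalars k) =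
      (LinearMap.range j).restrictScalars k := by
  apply le_antisymm
  · refine iSup_le fun a => iSup_le fun ψ => fun x hx => ?_
    exact LinearMap.range_comp_le_range (lof R A Ω a) j
      (range_le_range_of_rank_hom_le_one (hrank a) (comp_lof_ne_zero Ω j hj a) ψ hx)
  · intro x hx
    have hx' : x ∈ ⨆ a, LinearMap.range (j ∘ₗ lof R A Ω a) := by
      rw [← range_eq_iSup_range_comp_lof]; exact hx
    refine Submodule.iSup_induction
      (motive := fun y => y ∈ ⨆ a, ⨆ ψ : Ω a →ₗ[R] H, (LinearMap.range ψ).restrictScalars k)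
      _ hx' (fun a y hy => ?_) (zero_mem _) (fun y z hy hz => add_mem hy hz)
    exact Submodule.mem_iSup_of_mem a (Submodule.mem_iSup_of_mem (j ∘ₗ lof R A Ω a) hy)

/-- Step 1, inclusion form (the direction the combined reading uses): the intrinsic block lies in
the range of the pull-back map. [cite: Liu2021, Prop. 4.13, proof l. 2145; Thm. 4.18, proof ll. 2247–2270, eq. (4.2)] -/
theorem iSup_iSup_range_le_range_of_rank_hom_le_one [∀ a, Nontrivial (Ω a)]
    (hrank : ∀ a, Module.rank k (Ω a →ₗ[R] H) ≤ 1)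
    (j : (⨁ a, Ω a) →ₗ[R] H) (hj : Function.Injective j) :
    (⨆ a, ⨆ ψ : Ω a →ₗ[R] H, (LinearMap.range ψ).restrictScalars k) ≤
      (LinearMap.range j).restrictScalars k :=
  (iSup_iSup_range_eq_range_of_rank_hom_le_one Ω hrank j hj).le

end Family


/-! ### Step 1 from the five-sentence records instead (Prop. 4.13's decomposition + simplicity +
pairwise non-isomorphy): the route of the prose derivations of record, also in the kernel -/

section Decomposition

variable {k : Type*} [Field k] {R : Type*} [Ring R] [Algebra k R]
  {H : Type*} [AddCommGroup H] [Module R H] [Module k H] [IsScalarTower k R H]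
  {T : Type*} [DecidableEq T] (Ω' : T → Type*) [∀ t, AddCommGroup (Ω' t)] [∀ t, Module R (Ω' t)]

omit [DecidableEq T] in
/-- In a decomposition `H ≃ ⊕_t Ω' t` into simple, pairwise non-isomorphic summands
([Liu2021] Prop. 4.13 display; Def. 4.11; Thm. 4.18 (2) with App. D Lem. D.1 (3) — the
package's `Prop413`, `Irreducible`, `Thm418_2 ∧ MuSeparated` via `triple_eq_of_equiv`), an
equivariant map `Ω' t₀ → H` has zero component at every `t ≠ t₀` (Schur).
[cite: Liu2021, Prop. 4.13; Def. 4.11; Thm. 4.18 (2); App. D Lem. D.1 (3)] -/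
theorem component_comp_eq_zero_of_ne [∀ t, IsSimpleModule R (Ω' t)]
    (e : H ≃ₗ[R] ⨁ t, Ω' t) (hsep : ∀ t t', Nonempty (Ω' t ≃ₗ[R] Ω' t') → t = t')
    {t₀ t : T} (ht : t ≠ t₀) (θ : Ω' t₀ →ₗ[R] H) :
    component R T Ω' t ∘ₗ e.toLinearMap ∘ₗ θ = 0 := by
  rcases LinearMap.bijective_or_eq_zero (component R T Ω' t ∘ₗ e.toLinearMap ∘ₗ θ) with hb | h0
  · exact absurd (hsep t₀ t ⟨LinearEquiv.ofBijective _ hb⟩).symm ht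
  · exact h0

/-- Under the same hypotheses, the image of an equivariant `θ : Ω' t₀ → H` is concentrated in the
summand `t₀`: `e (θ s) = lof t₀ (component t₀ (e (θ s)))`. [folklore] -/
private theorem apply_eq_lof_component [∀ t, IsSimpleModule R (Ω' t)]
    (e : H ≃ₗ[R] ⨁ t, Ω' t) (hsep : ∀ t t', Nonempty (Ω' t ≃ₗ[R] Ω' t') → t = t')
    {t₀ : T} (θ : Ω' t₀ →ₗ[R] H) (s : Ω' t₀) :
    e (θ s) = lof R T Ω' t₀ ((component R T Ω' t₀ ∘ₗ e.toLinearMap ∘ₗ θ) s) := by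
  refine DirectSum.ext_component R fun t => ?_
  by_cases ht : t = t₀
  · subst ht
    rw [component.lof_self]
    rfl
  · rw [component.of, dif_neg (Ne.symm ht)]
    have h0 := LinearMap.congr_fun (component_comp_eq_zero_of_ne Ω' e hsep ht θ) s
    simpa using h0

/-- **Step 1, one summand, from the decomposition** ([Liu2021] Prop. 4.13 + Def. 4.11 +
Thm. 4.18 (2) / Lem. D.1 (3), i.e. the package's records (1)–(4)): if `H ≃ ⊕_t Ω' t` with simple,
pairwise non-isomorphic summands, then the range of ANY equivariant `ψ : Ω' t₀ → H` lies in the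
range of any fixed NON-ZERO equivariant `φ : Ω' t₀ → H` (both are the `t₀`-summand).  Schur's lemma
twice; no rank hypothesis.
[cite: Liu2021, Prop. 4.13; Def. 4.11; Thm. 4.18 (2) with proof l. 2270; App. D Lem. D.1 (3)] -/
theorem range_le_range_of_decomposition [∀ t, IsSimpleModule R (Ω' t)]
    (e : H ≃ₗ[R] ⨁ t, Ω' t) (hsep : ∀ t t', Nonempty (Ω' t ≃ₗ[R] Ω' t') → t = t')
    {t₀ : T} {φ : Ω' t₀ →ₗ[R] H} (hφ : φ ≠ 0) (ψ : Ω' t₀ →ₗ[R] H) :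
    LinearMap.range ψ ≤ LinearMap.range φ := by
  have key : ∀ (θ : Ω' t₀ →ₗ[R] H) (s : Ω' t₀),
      e (θ s) = lof R T Ω' t₀ ((component R T Ω' t₀ ∘ₗ e.toLinearMap ∘ₗ θ) s) :=
    fun θ s => apply_eq_lof_component Ω' e hsep θ s
  have hne : component R T Ω' t₀ ∘ₗ e.toLinearMap ∘ₗ φ ≠ 0 := by
    intro h0
    refine hφ (LinearMap.ext fun s => e.injective ?_)
    rw [key φ s, h0]
    simp only [LinearMap.zero_apply, map_zero]
  have hbij : Function.Bijective (component R T Ω' t₀ ∘ₗ e.toLinearMap ∘ₗ φ) :=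
    (LinearMap.bijective_or_eq_zero _).resolve_right hne
  rintro x ⟨s, rfl⟩
  obtain ⟨s', hs'⟩ := hbij.2 ((component R T Ω' t₀ ∘ₗ e.toLinearMap ∘ₗ ψ) s)
  refine ⟨s', e.injective ?_⟩
  rw [key φ s', key ψ s, hs']

/-- **STEP 1 FROM THE DECOMPOSITION, IN THE KERNEL** (the route of R8 §E / CF07 (iii) as
written: Prop. 4.13 + simplicity + pairwise non-isomorphy): for `H ≃ ⊕_t Ω' t` with simple pairwise
non-isomorphic summands and an injective equivariant `j : ⊕_a Ω' (σ a) → H` on a sub-family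
`σ : A → T` (at the model: `σ a = ⟨μ, a⟩`, `j` = the pull-back map (4.2) of Thm. 4.18's proof),
the intrinsic block `⨆_a ⨆_ψ range ψ` equals the range of `j`.  So on the five-sentence lineage
conjunct (5) is implied by conjuncts (1)–(4) together with the Thm 4.18 (1) reading of the map.
[cite: Liu2021, Prop. 4.13; Def. 4.11; Thm. 4.18 with proof ll. 2247–2270, eq. (4.2); Thm. 4.18 (2); App. D Lem. D.1 (3)] -/
theorem iSup_iSup_range_eq_range_of_decomposition [∀ t, IsSimpleModule R (Ω' t)]
    (e : H ≃ₗ[R] ⨁ t, Ω' t) (hsep : ∀ t t', Nonempty (Ω' t ≃ₗ[R] Ω' t') → t = t')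
    {A : Type*} [DecidableEq A] (σ : A → T)
    (j : (⨁ a, Ω' (σ a)) →ₗ[R] H) (hj : Function.Injective j) :
    (⨆ a, ⨆ ψ : Ω' (σ a) →ₗ[R] H, (LinearMap.range ψ).restrictScalars k) =
      (LinearMap.range j).restrictScalars k := by
  haveI : ∀ a, Nontrivial (Ω' (σ a)) := fun a => IsSimpleModule.nontrivial R (Ω' (σ a))
  apply le_antisymm
  · refine iSup_le fun a => iSup_le fun ψ => fun x hx => ?_
    exact LinearMap.range_comp_le_range (lof R A (fun a => Ω' (σ a)) a) j
      (range_le_range_of_decomposition Ω' e hsep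
        (comp_lof_ne_zero (fun a => Ω' (σ a)) j hj a) ψ hx)
  · intro x hx
    have hx' : x ∈ ⨆ a, LinearMap.range (j ∘ₗ lof R A (fun a => Ω' (σ a)) a) := by
      rw [← range_eq_iSup_range_comp_lof]; exact hx
    refine Submodule.iSup_induction
      (motive := fun y => y ∈ ⨆ a, ⨆ ψ : Ω' (σ a) →ₗ[R] H, (LinearMap.range ψ).restrictScalars k)
      _ hx' (fun a y hy => ?_) (zero_mem _) (fun y z hy hz => add_mem hy hz)
    exact Submodule.mem_iSup_of_mem a
      (Submodule.mem_iSup_of_mem (j ∘ₗ lof R A (fun a => Ω' (σ a)) a) hy)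

end Decomposition

/-! ### Glue: Step 1 + the Thm 4.18 (1) reading of the map ⇒ the consumed shape `Thm418Combined` -/

section CombinedReading

variable {k : Type*} [Field k] {R : Type*} [Ring R] [Algebra k R]
  {H : Type*} [AddCommGroup H] [Module R H] [Module k H] [IsScalarTower k R H]
  {Lvl : Type*} [Preorder Lvl] {W : Lvl → Type*} [∀ K, AddCommGroup (W K)] [∀ K, Module k (W K)]

/-- **Glue, one `μ`.**  If a `k`-subspace `block ≤ range j` (Step 1) and the `K`-fixed vectors in
the range of `j` restrict into `span (cmCl K)` below some level `K₀` (Steps 2–5 of the reading: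
[Liu2021] Thm. 4.18 (1), Rem. 4.17, Lem. 2.4 (1), functoriality of Betti `H¹` — kept as a
hypothesis about `j`), then the `K`-fixed vectors of `block` do so below the same `K₀`.
[cite: Liu2021, Thm. 4.18 (1) (l. 2239); Rem. 4.17 (ll. 2226–2228); Lem. 2.4 (1) (l. 1213)] -/
theorem combinedReading_of_block_le_range (block : Submodule k H) (Fix : Lvl → Submodule k H)
    (res : ∀ K, H →ₗ[k] W K) (cmCl : ∀ K, Set (W K))
    {D : Type*} [AddCommGroup D] [Module R D] (j : D →ₗ[R] H)
    (hblock : block ≤ (LinearMap.range j).restrictScalars k)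
    (hmap : ∃ K₀, ∀ K ≤ K₀, ∀ y : D, j y ∈ Fix K → res K (j y) ∈ Submodule.span k (cmCl K)) :
    ∃ K₀, ∀ K ≤ K₀, ∀ x ∈ block, x ∈ Fix K → res K x ∈ Submodule.span k (cmCl K) := by
  obtain ⟨K₀, hK₀⟩ := hmap
  refine ⟨K₀, fun K hK x hx hfix => ?_⟩
  obtain ⟨y, rfl⟩ := hblock hx
  exact hK₀ K hK y hfix

/-- **[Liu2021] Thm. 4.18 combined reading from the printed multiplicity one + the Thm 4.18 (1)
reading of the pull-back map, in the kernel** — the statement is the package's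
`LiuAlbaneseModuleDatum.Thm418Combined res cmCl` with `block μ = ⨆_a oscImage ⟨μ,a⟩`,
`oscImage t = ⨆_ψ range ψ` and `Ωt ⟨μ,a⟩ = Ω μ a` unfolded (`k = ℂ`, `R = ℂ[G]`,
`Fix K = fixedBy (Kof K) H`).  Hypotheses, each with its print anchor:
* `hmult` — multiplicity one, [Liu2021] proof of Prop. 4.13, l. 2145 (rank `≤ 1`);
* `j μ h`, `hj` — for `τ' ∈ Φ_μ` (`PhiMu μ`), an injective equivariant map `⊕_a ω(μ,a) → H`:
  the pull-back map (4.2) of the proof of Thm. 4.18 (ll. 2247–2270) through the isomorphism of its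
  statement; each `ω(μ,a) ≠ 0` (Def. 4.11, irreducible);
* `hmap` — the READING of Thm. 4.18 (1) + Rem. 4.17 + Lem. 2.4 (1) + functoriality for that map:
  below some level, `K`-fixed vectors in its image restrict into the span of the CM classes.
Conclusion: the consumed sentence for every `μ` with `τ' ∈ Φ_μ`.  (So, modulo the object match,
the consumed hypothesis follows from ONE verbatim sentence, l. 2145, and ONE reading of Thm. 4.18
about its own map — Thm. 4.18 (2) and the separation hypothesis are not needed.)
[cite: Liu2021, Prop. 4.13, proof l. 2145; Thm. 4.18 (main statement and (1)) with proof ll. 2247–2270, eq. (4.2); Rem. 4.17; Lem. 2.4 (1); Def. 4.11] -/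
theorem combinedReading_of_rank_hom_le_one {Char : Type*} {Adm : Char → Type*}
    [∀ μ, DecidableEq (Adm μ)] (Ω : ∀ μ : Char, Adm μ → Type*) [∀ μ a, AddCommGroup (Ω μ a)]
    [∀ μ a, Module R (Ω μ a)] [∀ μ a, Nontrivial (Ω μ a)] (PhiMu : Char → Prop)
    (Fix : Lvl → Submodule k H) (res : ∀ K, H →ₗ[k] W K) (cmCl : ∀ K, Char → Set (W K))
    (hmult : ∀ μ a, Module.rank k (Ω μ a →ₗ[R] H) ≤ 1)
    (j : ∀ μ, PhiMu μ → ((⨁ a, Ω μ a) →ₗ[R] H)) (hj : ∀ μ (h : PhiMu μ), Function.Injective (j μ h))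
    (hmap : ∀ μ (h : PhiMu μ), ∃ K₀, ∀ K ≤ K₀, ∀ y,
      j μ h y ∈ Fix K → res K (j μ h y) ∈ Submodule.span k (cmCl K μ)) :
    ∀ μ, PhiMu μ → ∃ K₀ : Lvl, ∀ K ≤ K₀,
      ∀ x ∈ (⨆ a, ⨆ ψ : Ω μ a →ₗ[R] H, (LinearMap.range ψ).restrictScalars k),
        x ∈ Fix K → res K x ∈ Submodule.span k (cmCl K μ) := fun μ h =>
  combinedReading_of_block_le_range _ Fix res (fun K => cmCl K μ) (j μ h)
    (iSup_iSup_range_le_range_of_rank_hom_le_one (Ω μ) (hmult μ) (j μ h) (hj μ h)) (hmap μ h)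

/-- **[Liu2021] Thm. 4.18 combined reading from the five-sentence records + the Thm 4.18 (1)
reading of the pull-back map, in the kernel** — same consumed shape as
`combinedReading_of_rank_hom_le_one`, but Step 1 taken from Prop. 4.13's decomposition
`e : H ≃ ⊕_{(μ,a)} Ω μ a` (`Prop413`), simplicity (`Irreducible`, Def. 4.11) and pairwise
non-isomorphy of the summands (`Thm418_2 ∧ MuSeparated`, Thm. 4.18 (2) / Lem. D.1 (3)) instead of
the rank bound.  Consequence for the five-conjunct binder: conjunct (5) follows from (1)–(4) and
the map reading `hmap`.
[cite: Liu2021, Prop. 4.13; Def. 4.11; Thm. 4.18 (main statement, (1), (2)) with proof ll. 2247–2270, eq. (4.2); Rem. 4.17; Lem. 2.4 (1); App. D Lem. D.1 (3)] -/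
theorem combinedReading_of_decomposition {Char : Type*} {Adm : Char → Type*} [DecidableEq Char]
    [∀ μ, DecidableEq (Adm μ)] (Ω : ∀ μ : Char, Adm μ → Type*) [∀ μ a, AddCommGroup (Ω μ a)]
    [∀ μ a, Module R (Ω μ a)] [∀ μ a, IsSimpleModule R (Ω μ a)] (PhiMu : Char → Prop)
    (Fix : Lvl → Submodule k H) (res : ∀ K, H →ₗ[k] W K) (cmCl : ∀ K, Char → Set (W K))
    (e : H ≃ₗ[R] ⨁ t : (Σ μ, Adm μ), Ω t.1 t.2)
    (hsep : ∀ t t' : (Σ μ, Adm μ), Nonempty (Ω t.1 t.2 ≃ₗ[R] Ω t'.1 t'.2) → t = t')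
    (j : ∀ μ, PhiMu μ → ((⨁ a, Ω μ a) →ₗ[R] H)) (hj : ∀ μ (h : PhiMu μ), Function.Injective (j μ h))
    (hmap : ∀ μ (h : PhiMu μ), ∃ K₀, ∀ K ≤ K₀, ∀ y,
      j μ h y ∈ Fix K → res K (j μ h y) ∈ Submodule.span k (cmCl K μ)) :
    ∀ μ, PhiMu μ → ∃ K₀ : Lvl, ∀ K ≤ K₀,
      ∀ x ∈ (⨆ a, ⨆ ψ : Ω μ a →ₗ[R] H, (LinearMap.range ψ).restrictScalars k),
        x ∈ Fix K → res K x ∈ Submodule.span k (cmCl K μ) := fun μ h =>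
  combinedReading_of_block_le_range _ Fix res (fun K => cmCl K μ) (j μ h)
    (iSup_iSup_range_eq_range_of_decomposition (fun t : (Σ μ, Adm μ) => Ω t.1 t.2) e hsep
      (fun a : Adm μ => (⟨μ, a⟩ : Σ μ, Adm μ)) (j μ h) (hj μ h)).le (hmap μ h)

end CombinedReading

/-! ### The specialisation at the model's rings: `k = ℂ`, `R = ℂ[G]` -/

section GroupAlgebra

variable {G : Type*} [Group G] {H : Type*} [AddCommGroup H] [Module ℂ H]
  [Module (MonoidAlgebra ℂ G) H] [IsScalarTower ℂ (MonoidAlgebra ℂ G) H]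
  {A : Type*} [DecidableEq A] (Ω : A → Type*) [∀ a, AddCommGroup (Ω a)]
  [∀ a, Module (MonoidAlgebra ℂ G) (Ω a)]

/-- **Step 1 at `ℂ[G]`** (the package's rings; `G = U(𝕍)(𝔸_F^∞)` at the model): for an injective
`ℂ[G]`-linear `j : ⊕_a Ω a → H` with non-zero summands and multiplicity one
`Module.rank ℂ (Ω a →ₗ[ℂ[G]] H) ≤ 1` ([Liu2021] l. 2145), the intrinsic block
`⨆_a ⨆_ψ range ψ` (as a `ℂ`-subspace of `H`) is the range of `j`.
[cite: Liu2021, Prop. 4.13, proof l. 2145; Thm. 4.18, proof ll. 2247–2270, eq. (4.2); Def. 4.11] -/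
theorem groupAlgebra_block_eq_range [∀ a, Nontrivial (Ω a)]
    (hrank : ∀ a, Module.rank ℂ (Ω a →ₗ[MonoidAlgebra ℂ G] H) ≤ 1)
    (j : (⨁ a, Ω a) →ₗ[MonoidAlgebra ℂ G] H) (hj : Function.Injective j) :
    (⨆ a, ⨆ ψ : Ω a →ₗ[MonoidAlgebra ℂ G] H, (LinearMap.range ψ).restrictScalars ℂ) =
      (LinearMap.range j).restrictScalars ℂ :=
  iSup_iSup_range_eq_range_of_rank_hom_le_one Ω hrank j hj

end GroupAlgebra

end Literature.RepresentationTheory.Liu2021
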